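import Summits.Ventures.HSemireg.WedgeHankelRecurrenceGaussZerosTraceBalance

/-!
# Venture HSemireg — **WEYL'S PERTURBATION BOUND FOR THE WHOLE RECURRENCE (diagonal AND couplings)**: for two positive recurrences with `|a'_i − a_i| ≤ α` (`i ≤ t`) and
# `|√b'_j − √b_j| ≤ δ` (`1 ≤ j ≤ t`), every zero moves by at most `α + 2δ`: `|y_k − x_k| ≤ α + 2δ` for the increasing zeros of `q_{t+1}`, `q'_{t+1}` — the row-sum (Gershgorin) norm of the
# change of the Jacobi matrix `tridiag(√b, a, √b)`; N324 was the case `δ = 0`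

HONEST FRAMING. Part of the Lean index of the computation cell `pub-hsemireg` (seat p10 gen 45, Sunday typer «UNIFORM-IN-n»).  Real polynomials, finite sums and `Real.sqrt` only; no variety, no
cohomology theory, no sheaf, no Ext group and no semiregularity map is constructed here; nothing here says that HC / HC_CM / HC_AV holds; no Literature fact (unproved `Prop`) is declared or used.
Custodian versions as in `WedgeHankelSiegelIdeal` (1/3).
SOURCES (cited).  H. Weyl, Math. Ann. 71 (1912) 441–479 (`|λ_k(A + E) − λ_k(A)| ≤ ‖E‖`); R. A. Horn, C. R. Johnson, *Matrix Analysis* (2nd ed.) Thm 4.3.1 ∕ Cor. 6.3.8 with the bound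
`‖E‖₂ ≤ max_i Σ_j |E_{ij}|`; B. N. Parlett, *The Symmetric Eigenvalue Problem* (1980) §10.1; J. H. Wilkinson, *The Algebraic Eigenvalue Problem* (1965) Ch. 2 §44 (perturbations of symmetric
tridiagonal matrices).
PROOF TYPED HERE (no matrices).  In the Favard coordinates of N323 ∕ N346 (`u_i = v_i √(h_i∕h'_i)`): the diagonal terms of `Σ μ' y P'_u² − Σ μ x P_v²` are `(a'_i − a_i) h_i v_i²`, and the cross
term at `(i, i+1)` is `v_i v_{i+1} h_i √b_{i+1} (√b'_{i+1} − √b_{i+1})` (the rescaling identity `s_i s_{i+1} h'_{i+1} = h_i √(b_{i+1} b'_{i+1})`, proved by squaring), bounded by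
`δ (h_i v_i² + h_{i+1} v_{i+1}²)∕2` (AM–GM); each coordinate has at most two neighbours, so `|Σ μ' y P'_u² − Σ μ x P_v²| ≤ (α + 2δ) Σ h_i v_i²`; the test vector of N323 (`k` conditions below on
the `y`-side, `t − k` above on the `x`-side) gives `y_k ≤ x_k + α + 2δ`, and symmetry the other inequality.
DEDUP DISCLOSURE (`rg -n 'perturbation' Summits/Ventures/HSemireg`, 2026-09-03): N324 `zeros_perturbation_diagonal` (couplings fixed), N333 `top_perturbation_*` (top entry); the coupling part is
new.  The 5 names below: 0 hits tree-wide.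

WHAT IS IN THE TREE.  N323 `favard_pairing_at_zeros`, `favard_norm_sq_combination`, `favard_x_pairing`, `weighted_sq_combination_expand`, `exists_jacobi_test_vector`; N325 `prod_Ico_one_succ_succ`,
`sqrt_rescale_sq`; N346 `favard_forms_rescaled` (norm of the rescaled vector).
THIS FILE (namespace `Summit.Ventures.HSemireg.Wedge.HankelOuter` continued; CHAINED on N353 (import only); 0 definitions):
* §1119 `rescale_cross_eq` (`s_i s_{i+1} h'_{i+1} = h_i √b_{i+1} √b'_{i+1}`), `two_mul_abs_cross_le` (AM–GM for the cross term), **`favard_forms_rescaled_abs_le`**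
  (`|Σ μ' y P'_u² − Σ μ x P_v²| ≤ (α + 2δ) Σ h_i v_i²`), `zeros_perturbation_full_upper` (`y_k ≤ x_k + α + 2δ`), **`zeros_perturbation_full`** (`|y_k − x_k| ≤ α + 2δ`).
CAVEATS.  Positive recurrences; the bound is the row-sum norm, not the spectral norm, of the change.  Nothing Ext-side.  New names only.
-/

open Module Polynomial
open scoped Matrix Polynomial

namespace Summit.Ventures.HSemireg.Wedge.HankelOuter

/-! ## §1119. Weyl's perturbation bound with couplings -/

/-- **The rescaling identity for neighbouring coordinates: `s_i s_{i+1} h'_{i+1} = h_i √b_{i+1} √b'_{i+1}`** (`h_n = b_1⋯b_n`, `h'_n = b'_1⋯b'_n`, `s_n = √(h_n∕h'_n)`; all `b, b' > 0`).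
[bookkeeping; this file, §1119] -/
theorem rescale_cross_eq {b b' : ℕ → ℝ} (hb : ∀ j, 0 < b j) (hb' : ∀ j, 0 < b' j) (i : ℕ) :
    Real.sqrt ((∏ l ∈ Finset.Ico 1 (i + 1), b l) / ∏ l ∈ Finset.Ico 1 (i + 1), b' l) * Real.sqrt ((∏ l ∈ Finset.Ico 1 (i + 1 + 1), b l) / ∏ l ∈ Finset.Ico 1 (i + 1 + 1), b' l) *
        ∏ l ∈ Finset.Ico 1 (i + 1 + 1), b' l = (∏ l ∈ Finset.Ico 1 (i + 1), b l) * (Real.sqrt (b (i + 1)) * Real.sqrt (b' (i + 1))) := by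
  rw [prod_Ico_one_succ_succ b i, prod_Ico_one_succ_succ b' i]
  obtain ⟨A, hA⟩ : ∃ A : ℝ, A = ∏ l ∈ Finset.Ico 1 (i + 1), b l := ⟨_, rfl⟩
  obtain ⟨A', hA'⟩ : ∃ A' : ℝ, A' = ∏ l ∈ Finset.Ico 1 (i + 1), b' l := ⟨_, rfl⟩
  have hApos : 0 < A := by rw [hA]; exact Finset.prod_pos fun l _ => hb l
  have hA'pos : 0 < A' := by rw [hA']; exact Finset.prod_pos fun l _ => hb' l
  rw [← hA, ← hA']
  have hβ := hb (i + 1)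
  have hβ' := hb' (i + 1)
  -- compare squares of two non-negative reals
  have hL : 0 ≤ Real.sqrt (A / A') * Real.sqrt (A * b (i + 1) / (A' * b' (i + 1))) * (A' * b' (i + 1)) := by positivity
  have hR : 0 ≤ A * (Real.sqrt (b (i + 1)) * Real.sqrt (b' (i + 1))) := by positivity
  refine (pow_left_inj₀ hL hR two_ne_zero).1 ?_
  simp only [mul_pow, Real.sq_sqrt (div_nonneg hApos.le hA'pos.le), Real.sq_sqrt (show 0 ≤ A * b (i + 1) / (A' * b' (i + 1)) by positivity), Real.sq_sqrt hβ.le, Real.sq_sqrt hβ'.le]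
  field_simp

/-- **AM–GM for the cross term: `2 |v w h √β| ≤ h v² + h β w²`** (`h ≥ 0`, `β ≥ 0`). [bookkeeping; this file, §1119] -/
theorem two_mul_abs_cross_le {h β v w : ℝ} (hh : 0 ≤ h) (hβ : 0 ≤ β) : 2 * |v * w * h * Real.sqrt β| ≤ h * v ^ 2 + h * β * w ^ 2 := by
  have hs : Real.sqrt β ^ 2 = β := Real.sq_sqrt hβ
  have e1 : h * (v - Real.sqrt β * w) ^ 2 = h * v ^ 2 + h * (Real.sqrt β ^ 2) * w ^ 2 - 2 * (v * w * h * Real.sqrt β) := by ring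
  have e2 : h * (v + Real.sqrt β * w) ^ 2 = h * v ^ 2 + h * (Real.sqrt β ^ 2) * w ^ 2 + 2 * (v * w * h * Real.sqrt β) := by ring
  rw [hs] at e1 e2
  have h1 : 0 ≤ h * (v - Real.sqrt β * w) ^ 2 := mul_nonneg hh (sq_nonneg _)
  have h2 : 0 ≤ h * (v + Real.sqrt β * w) ^ 2 := mul_nonneg hh (sq_nonneg _)
  rcases abs_cases (v * w * h * Real.sqrt β) with ⟨hc, _⟩ | ⟨hc, _⟩ <;> rw [hc] <;> linarith

/-- **`|Σ μ' y P'_u² − Σ μ x P_v²| ≤ (α + 2δ) Σ h_i v_i²`** for the rescaled vector `u_i = v_i √(h_i∕h'_i)`, when `|a'_i − a_i| ≤ α` (`i ≤ t`) and `|√b'_j − √b_j| ≤ δ` (`1 ≤ j ≤ t`, `δ ≥ 0`).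
[Weyl 1912; Wilkinson Ch. 2 §44; this file, §1119] -/
theorem favard_forms_rescaled_abs_le {q q' : ℕ → ℝ[X]} {a a' b b' : ℕ → ℝ} (hq0 : q 0 = 1) (hq1 : q 1 = Polynomial.X - C (a 0))
    (hrec : ∀ n, q (n + 2) = (Polynomial.X - C (a (n + 1))) * q (n + 1) - C (b (n + 1)) * q n)
    (hq0' : q' 0 = 1) (hq1' : q' 1 = Polynomial.X - C (a' 0)) (hrec' : ∀ n, q' (n + 2) = (Polynomial.X - C (a' (n + 1))) * q' (n + 1) - C (b' (n + 1)) * q' n)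
    (hb : ∀ j, 0 < b j) (hb' : ∀ j, 0 < b' j)
    {t : ℕ} {μ x μ' y : Fin (t + 1) → ℝ} (hxr : ∀ k, (q (t + 1)).eval (x k) = 0) (hyr : ∀ k, (q' (t + 1)).eval (y k) = 0)
    (hpair : ∀ i j : Fin (t + 1), ∑ k, μ k * ((q i).eval (x k) * (q j).eval (x k)) = if i = j then ∏ l ∈ Finset.Ico 1 ((j : ℕ) + 1), b l else 0)
    (hpair' : ∀ i j : Fin (t + 1), ∑ k, μ' k * ((q' i).eval (y k) * (q' j).eval (y k)) = if i = j then ∏ l ∈ Finset.Ico 1 ((j : ℕ) + 1), b' l else 0)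
    {α δ : ℝ} (hα : ∀ i, i ≤ t → |a' i - a i| ≤ α) (hδ0 : 0 ≤ δ) (hδ : ∀ j, 1 ≤ j → j ≤ t → |Real.sqrt (b' j) - Real.sqrt (b j)| ≤ δ)
    (v u : Fin (t + 1) → ℝ) (hu : ∀ i, u i = v i * Real.sqrt ((∏ l ∈ Finset.Ico 1 ((i : ℕ) + 1), b l) / ∏ l ∈ Finset.Ico 1 ((i : ℕ) + 1), b' l)) :
    |∑ k, μ' k * (y k * ((∑ i : Fin (t + 1), C (u i) * q' i).eval (y k)) ^ 2) - ∑ k, μ k * (x k * ((∑ i : Fin (t + 1), C (v i) * q i).eval (x k)) ^ 2)| ≤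
      (α + 2 * δ) * ∑ i : Fin (t + 1), (∏ l ∈ Finset.Ico 1 ((i : ℕ) + 1), b l) * v i ^ 2 := by
  classical
  have hH : ∀ n, 0 < ∏ l ∈ Finset.Ico 1 (n + 1), b l := fun n => Finset.prod_pos fun l _ => hb l
  have hH' : ∀ n, 0 < ∏ l ∈ Finset.Ico 1 (n + 1), b' l := fun n => Finset.prod_pos fun l _ => hb' l
  obtain ⟨s, hs⟩ : ∃ s : Fin (t + 1) → ℝ, s = fun (i : Fin (t + 1)) => Real.sqrt ((∏ l ∈ Finset.Ico 1 ((i : ℕ) + 1), b l) / ∏ l ∈ Finset.Ico 1 ((i : ℕ) + 1), b' l) := ⟨_, rfl⟩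
  have hus : ∀ i, u i = v i * s i := fun i => by rw [hu, hs]
  have hs2 : ∀ i : Fin (t + 1), (∏ l ∈ Finset.Ico 1 ((i : ℕ) + 1), b' l) * s i ^ 2 = ∏ l ∈ Finset.Ico 1 ((i : ℕ) + 1), b l := fun i => by
    rw [hs]; exact sqrt_rescale_sq (hH i).le (hH' i)
  -- neighbouring rescaling factors
  have hcross : ∀ i j : Fin (t + 1), (i : ℕ) + 1 = j →
      s i * s j * ∏ l ∈ Finset.Ico 1 ((j : ℕ) + 1), b' l = (∏ l ∈ Finset.Ico 1 ((i : ℕ) + 1), b l) * (Real.sqrt (b j) * Real.sqrt (b' j)) := fun i j hij => by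
    rw [hs]
    dsimp only
    rw [← hij]
    exact rescale_cross_eq hb hb' i
  -- abbreviations: the weighted squares `G_i = h_i v_i²`
  obtain ⟨Gi, hGi⟩ : ∃ Gi : Fin (t + 1) → ℝ, Gi = fun (i : Fin (t + 1)) => (∏ l ∈ Finset.Ico 1 ((i : ℕ) + 1), b l) * v i ^ 2 := ⟨_, rfl⟩
  have hGi0 : ∀ i, 0 ≤ Gi i := fun i => by rw [hGi]; exact mul_nonneg (hH i).le (sq_nonneg _)
  have hev : ∀ (w : Fin (t + 1) → ℝ) (r : ℕ → ℝ[X]) (z : ℝ), (∑ i : Fin (t + 1), C (w i) * r i).eval z = ∑ i : Fin (t + 1), w i * (r i).eval z := fun w r z => by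
    rw [eval_finsetSum]; exact Finset.sum_congr rfl fun i _ => by rw [eval_mul, eval_C]
  simp_rw [hev]
  rw [weighted_sq_combination_expand μ' y (fun (i : Fin (t + 1)) k => (q' i).eval (y k)) u, weighted_sq_combination_expand μ x (fun (i : Fin (t + 1)) k => (q i).eval (x k)) v,
    ← Finset.sum_sub_distrib]
  simp_rw [← Finset.sum_sub_distrib]
  -- termwise bound
  have hterm : ∀ i j : Fin (t + 1),
      |u i * u j * ∑ k, μ' k * (y k * ((q' i).eval (y k) * (q' j).eval (y k))) - v i * v j * ∑ k, μ k * (x k * ((q i).eval (x k) * (q j).eval (x k)))| ≤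
        (if i = j then α * Gi i else 0) + (if (i : ℕ) + 1 = j ∨ (j : ℕ) + 1 = i then δ * (Gi i + Gi j) / 2 else 0) := by
    intro i j
    rw [favard_x_pairing hq0' hq1' hrec' hyr hpair' i j, favard_x_pairing hq0 hq1 hrec hxr hpair i j]
    have huu : u i * u j = v i * v j * (s i * s j) := by rw [hus, hus]; ring
    by_cases h1 : (i : ℕ) + 1 = j
    · -- upper neighbour: only the first summand survives
      have h2 : ¬ ((i : ℕ) = j) := by omega
      have h3 : ¬ ((i : ℕ) = j + 1) := by omega
      have hij : i ≠ j := fun h => h2 (congrArg Fin.val h)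
      rw [if_pos h1, if_pos h1, if_neg h2, if_neg h2, if_neg h3, if_neg h3, if_neg hij, if_pos (Or.inl h1)]
      simp only [add_zero, zero_add]
      rw [huu, show v i * v j * (s i * s j) * ∏ l ∈ Finset.Ico 1 ((j : ℕ) + 1), b' l = v i * v j * (s i * s j * ∏ l ∈ Finset.Ico 1 ((j : ℕ) + 1), b' l) by ring, hcross i j h1]
      -- `h_j = h_i b_j`
      have hj : ∏ l ∈ Finset.Ico 1 ((j : ℕ) + 1), b l = (∏ l ∈ Finset.Ico 1 ((i : ℕ) + 1), b l) * b j := by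
        rw [← h1, prod_Ico_one_succ_succ b i]
      have hδj := hδ j (by omega) (by omega)
      have hsb : Real.sqrt (b j) ^ 2 = b j := Real.sq_sqrt (hb j).le
      rw [hj, hGi]
      dsimp only
      rw [hj]
      have key : v i * v j * ((∏ l ∈ Finset.Ico 1 ((i : ℕ) + 1), b l) * (Real.sqrt (b j) * Real.sqrt (b' j))) - v i * v j * ((∏ l ∈ Finset.Ico 1 ((i : ℕ) + 1), b l) * b j) =
          (v i * v j * (∏ l ∈ Finset.Ico 1 ((i : ℕ) + 1), b l) * Real.sqrt (b j)) * (Real.sqrt (b' j) - Real.sqrt (b j)) := by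
        linear_combination (v i * v j * ∏ l ∈ Finset.Ico 1 ((i : ℕ) + 1), b l) * hsb
      rw [key, abs_mul]
      have hAM := two_mul_abs_cross_le (v := v i) (w := v j) (hH i).le (hb j).le
      calc |v i * v j * (∏ l ∈ Finset.Ico 1 ((i : ℕ) + 1), b l) * Real.sqrt (b j)| * |Real.sqrt (b' j) - Real.sqrt (b j)|
          ≤ ((∏ l ∈ Finset.Ico 1 ((i : ℕ) + 1), b l) * v i ^ 2 + (∏ l ∈ Finset.Ico 1 ((i : ℕ) + 1), b l) * b j * v j ^ 2) / 2 * δ :=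
            mul_le_mul (by linarith) hδj (abs_nonneg _) (by linarith [abs_nonneg (v i * v j * (∏ l ∈ Finset.Ico 1 ((i : ℕ) + 1), b l) * Real.sqrt (b j))])
        _ = δ * ((∏ l ∈ Finset.Ico 1 ((i : ℕ) + 1), b l) * v i ^ 2 + (∏ l ∈ Finset.Ico 1 ((i : ℕ) + 1), b l) * b j * v j ^ 2) / 2 := by ring
    · by_cases h3 : (j : ℕ) + 1 = i
      · -- lower neighbour: only the third summand survives
        have h2 : ¬ ((i : ℕ) = j) := by omega
        have h3' : (i : ℕ) = j + 1 := h3.symm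
        have hij : i ≠ j := fun h => h2 (congrArg Fin.val h)
        rw [if_neg h1, if_neg h1, if_neg h2, if_neg h2, if_pos h3', if_pos h3', if_neg hij, if_pos (Or.inr h3)]
        simp only [zero_add]
        rw [huu, show v i * v j * (s i * s j) * ∏ l ∈ Finset.Ico 1 ((i : ℕ) + 1), b' l = v j * v i * (s j * s i * ∏ l ∈ Finset.Ico 1 ((i : ℕ) + 1), b' l) by ring, hcross j i h3]
        have hi : ∏ l ∈ Finset.Ico 1 ((i : ℕ) + 1), b l = (∏ l ∈ Finset.Ico 1 ((j : ℕ) + 1), b l) * b i := by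
          rw [← h3, prod_Ico_one_succ_succ b j]
        have hδi := hδ i (by omega) (by omega)
        have hsb : Real.sqrt (b i) ^ 2 = b i := Real.sq_sqrt (hb i).le
        rw [hi, hGi]
        dsimp only
        rw [hi]
        have key : v j * v i * ((∏ l ∈ Finset.Ico 1 ((j : ℕ) + 1), b l) * (Real.sqrt (b i) * Real.sqrt (b' i))) - v i * v j * ((∏ l ∈ Finset.Ico 1 ((j : ℕ) + 1), b l) * b i) =
            (v j * v i * (∏ l ∈ Finset.Ico 1 ((j : ℕ) + 1), b l) * Real.sqrt (b i)) * (Real.sqrt (b' i) - Real.sqrt (b i)) := by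
          linear_combination (v j * v i * ∏ l ∈ Finset.Ico 1 ((j : ℕ) + 1), b l) * hsb
        rw [key, abs_mul]
        have hAM := two_mul_abs_cross_le (v := v j) (w := v i) (hH j).le (hb i).le
        calc |v j * v i * (∏ l ∈ Finset.Ico 1 ((j : ℕ) + 1), b l) * Real.sqrt (b i)| * |Real.sqrt (b' i) - Real.sqrt (b i)|
            ≤ ((∏ l ∈ Finset.Ico 1 ((j : ℕ) + 1), b l) * v j ^ 2 + (∏ l ∈ Finset.Ico 1 ((j : ℕ) + 1), b l) * b i * v i ^ 2) / 2 * δ :=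
              mul_le_mul (by linarith) hδi (abs_nonneg _) (by linarith [abs_nonneg (v j * v i * (∏ l ∈ Finset.Ico 1 ((j : ℕ) + 1), b l) * Real.sqrt (b i))])
          _ = δ * ((∏ l ∈ Finset.Ico 1 ((j : ℕ) + 1), b l) * b i * v i ^ 2 + (∏ l ∈ Finset.Ico 1 ((j : ℕ) + 1), b l) * v j ^ 2) / 2 := by ring
      · -- not neighbours: diagonal or zero
        have h3' : ¬ ((i : ℕ) = j + 1) := fun h => h3 (by omega)
        rw [if_neg h1, if_neg h1, if_neg h3', if_neg h3', if_neg (not_or.2 ⟨h1, h3⟩)]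
        simp only [zero_add, add_zero]
        by_cases hij : i = j
        · subst hij
          rw [if_pos rfl, if_pos rfl, if_pos rfl, huu, hGi]
          dsimp only
          have : v i * v i * (s i * s i) * (a' i * ∏ l ∈ Finset.Ico 1 ((i : ℕ) + 1), b' l) - v i * v i * (a i * ∏ l ∈ Finset.Ico 1 ((i : ℕ) + 1), b l) =
              (a' i - a i) * ((∏ l ∈ Finset.Ico 1 ((i : ℕ) + 1), b l) * v i ^ 2) := by
            rw [show v i * v i * (s i * s i) * (a' i * ∏ l ∈ Finset.Ico 1 ((i : ℕ) + 1), b' l) = v i * v i * (a' i * ((∏ l ∈ Finset.Ico 1 ((i : ℕ) + 1), b' l) * s i ^ 2)) by ring, hs2 i]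
            ring
          rw [this, abs_mul, abs_of_nonneg (mul_nonneg (hH i).le (sq_nonneg _))]
          exact mul_le_mul_of_nonneg_right (hα i (Nat.lt_succ_iff.1 i.is_lt)) (mul_nonneg (hH i).le (sq_nonneg _))
        · have hij' : ¬ ((i : ℕ) = j) := fun h => hij (Fin.ext h)
          rw [if_neg hij, if_neg hij', if_neg hij', mul_zero, mul_zero, sub_self, abs_zero]
  -- summing the bounds
  have hsum : ∑ i, ∑ j, ((if i = j then α * Gi i else 0) + (if (i : ℕ) + 1 = j ∨ (j : ℕ) + 1 = i then δ * (Gi i + Gi j) / 2 else 0)) ≤ (α + 2 * δ) * ∑ i, Gi i := by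
    simp_rw [Finset.sum_add_distrib]
    have hdiag : ∑ i : Fin (t + 1), ∑ j, (if i = j then α * Gi i else 0) = α * ∑ i, Gi i := by
      rw [Finset.mul_sum]; exact Finset.sum_congr rfl fun i _ => by rw [Finset.sum_ite_eq, if_pos (Finset.mem_univ _)]
    -- the neighbour sum: symmetrise, then each coordinate has at most two neighbours
    have hsymm : ∑ i : Fin (t + 1), ∑ j : Fin (t + 1), (if (i : ℕ) + 1 = j ∨ (j : ℕ) + 1 = i then δ * (Gi i + Gi j) / 2 else 0) =
        ∑ i : Fin (t + 1), ∑ j : Fin (t + 1), (if (i : ℕ) + 1 = j ∨ (j : ℕ) + 1 = i then δ * Gi i else 0) := by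
      have h1 : ∑ i : Fin (t + 1), ∑ j : Fin (t + 1), (if (i : ℕ) + 1 = j ∨ (j : ℕ) + 1 = i then δ * Gi j / 2 else 0) =
          ∑ i : Fin (t + 1), ∑ j : Fin (t + 1), (if (i : ℕ) + 1 = j ∨ (j : ℕ) + 1 = i then δ * Gi i / 2 else 0) := by
        rw [Finset.sum_comm]
        exact Finset.sum_congr rfl fun i _ => Finset.sum_congr rfl fun j _ => by simp only [or_comm]
      have h2 : ∀ i j : Fin (t + 1), (if (i : ℕ) + 1 = j ∨ (j : ℕ) + 1 = i then δ * (Gi i + Gi j) / 2 else 0) =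
          (if (i : ℕ) + 1 = j ∨ (j : ℕ) + 1 = i then δ * Gi i / 2 else 0) + (if (i : ℕ) + 1 = j ∨ (j : ℕ) + 1 = i then δ * Gi j / 2 else 0) := fun i j => by
        split_ifs <;> ring
      simp_rw [h2, Finset.sum_add_distrib]
      rw [h1, ← Finset.sum_add_distrib]
      refine Finset.sum_congr rfl fun i _ => ?_
      rw [← Finset.sum_add_distrib]
      exact Finset.sum_congr rfl fun j _ => by split_ifs <;> ring
    have hnb : ∀ i : Fin (t + 1), ∑ j : Fin (t + 1), (if (i : ℕ) + 1 = j ∨ (j : ℕ) + 1 = i then δ * Gi i else 0) ≤ 2 * (δ * Gi i) := by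
      intro i
      rw [← Finset.sum_filter, Finset.sum_const, nsmul_eq_mul]
      have hcard : ((Finset.univ : Finset (Fin (t + 1))).filter (fun j : Fin (t + 1) => (i : ℕ) + 1 = (j : ℕ) ∨ (j : ℕ) + 1 = (i : ℕ))).card ≤ 2 := by
        refine (Finset.card_le_card_of_injOn (s := (Finset.univ : Finset (Fin (t + 1))).filter (fun j : Fin (t + 1) => (i : ℕ) + 1 = (j : ℕ) ∨ (j : ℕ) + 1 = (i : ℕ)))
          (t := ({(i : ℕ) + 1, (i : ℕ) - 1} : Finset ℕ)) (fun j : Fin (t + 1) => (j : ℕ)) (fun j hj => ?_) (fun j _ j' _ h => Fin.ext h)).trans ?_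
        · have h := (Finset.mem_filter.1 (Finset.mem_coe.1 hj)).2
          refine Finset.mem_coe.2 ?_
          simp only [Finset.mem_insert, Finset.mem_singleton]
          omega
        · exact (Finset.card_insert_le _ _).trans (by rw [Finset.card_singleton])
      exact mul_le_mul_of_nonneg_right (by exact_mod_cast hcard) (mul_nonneg hδ0 (hGi0 i))
    rw [hdiag, hsymm, add_mul, Finset.mul_sum, Finset.mul_sum]
    refine add_le_add le_rfl (Finset.sum_le_sum fun i _ => ?_)
    calc ∑ j : Fin (t + 1), (if (i : ℕ) + 1 = j ∨ (j : ℕ) + 1 = i then δ * Gi i else 0) ≤ 2 * (δ * Gi i) := hnb i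
      _ = 2 * δ * Gi i := by ring
  refine le_trans (Finset.abs_sum_le_sum_abs _ _) (le_trans (Finset.sum_le_sum fun i _ => (Finset.abs_sum_le_sum_abs _ _).trans (Finset.sum_le_sum fun j _ => hterm i j)) ?_)
  simpa only [hGi] using hsum

/-- **One-sided Weyl bound: `y_k ≤ x_k + (α + 2δ)`.** [Weyl 1912; Horn–Johnson Thm 4.3.1; this file, §1119] -/
theorem zeros_perturbation_full_upper {q q' : ℕ → ℝ[X]} {a a' b b' : ℕ → ℝ} (hq0 : q 0 = 1) (hq1 : q 1 = Polynomial.X - C (a 0))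
    (hrec : ∀ n, q (n + 2) = (Polynomial.X - C (a (n + 1))) * q (n + 1) - C (b (n + 1)) * q n)
    (hq0' : q' 0 = 1) (hq1' : q' 1 = Polynomial.X - C (a' 0)) (hrec' : ∀ n, q' (n + 2) = (Polynomial.X - C (a' (n + 1))) * q' (n + 1) - C (b' (n + 1)) * q' n)
    (hb : ∀ j, 0 < b j) (hb' : ∀ j, 0 < b' j) {t : ℕ} {α δ : ℝ} (hα : ∀ i, i ≤ t → |a' i - a i| ≤ α) (hδ0 : 0 ≤ δ)
    (hδ : ∀ j, 1 ≤ j → j ≤ t → |Real.sqrt (b' j) - Real.sqrt (b j)| ≤ δ)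
    {x y : Fin (t + 1) → ℝ} (hx : StrictMono x) (hxq : q (t + 1) = ∏ j, (Polynomial.X - C (x j))) (hy : StrictMono y) (hyq : q' (t + 1) = ∏ j, (Polynomial.X - C (y j)))
    (k : Fin (t + 1)) : y k ≤ x k + (α + 2 * δ) := by
  classical
  obtain ⟨μ, hμ, hpair⟩ := favard_pairing_at_zeros hq0 hq1 hrec hb hx hxq
  obtain ⟨μ', hμ', hpair'⟩ := favard_pairing_at_zeros hq0' hq1' hrec' hb' hy hyq
  have hxr : ∀ j, (q (t + 1)).eval (x j) = 0 := fun j => by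
    rw [hxq, eval_prod]; exact Finset.prod_eq_zero (Finset.mem_univ j) (by rw [eval_sub, eval_X, eval_C, sub_self])
  have hyr : ∀ j, (q' (t + 1)).eval (y j) = 0 := fun j => by
    rw [hyq, eval_prod]; exact Finset.prod_eq_zero (Finset.mem_univ j) (by rw [eval_sub, eval_X, eval_C, sub_self])
  obtain ⟨s, hs⟩ : ∃ s : Fin (t + 1) → ℝ, s = fun (i : Fin (t + 1)) => Real.sqrt ((∏ l ∈ Finset.Ico 1 ((i : ℕ) + 1), b l) / ∏ l ∈ Finset.Ico 1 ((i : ℕ) + 1), b' l) := ⟨_, rfl⟩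
  obtain ⟨v, hv0, hvy, hvx⟩ := exists_jacobi_test_vector (fun i j => s i * (q' i).eval (y j)) (fun i j => (q i).eval (x j)) k
  obtain ⟨u, hu⟩ : ∃ u : Fin (t + 1) → ℝ, u = fun i => v i * s i := ⟨_, rfl⟩
  have huv : ∀ i, u i = v i * Real.sqrt ((∏ l ∈ Finset.Ico 1 ((i : ℕ) + 1), b l) / ∏ l ∈ Finset.Ico 1 ((i : ℕ) + 1), b' l) := fun i => by rw [hu, hs]
  obtain ⟨P, hP⟩ : ∃ P : ℝ[X], P = ∑ i : Fin (t + 1), C (v i) * q i := ⟨_, rfl⟩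
  obtain ⟨P', hP'⟩ : ∃ P' : ℝ[X], P' = ∑ i : Fin (t + 1), C (u i) * q' i := ⟨_, rfl⟩
  have hev : ∀ (w : Fin (t + 1) → ℝ) (r : ℕ → ℝ[X]) (z : ℝ), (∑ i : Fin (t + 1), C (w i) * r i).eval z = ∑ i : Fin (t + 1), w i * (r i).eval z := fun w r z => by
    rw [eval_finsetSum]; exact Finset.sum_congr rfl fun i _ => by rw [eval_mul, eval_C]
  have hPy : ∀ j, j < k → P'.eval (y j) = 0 := fun j hj => by
    rw [hP', hev, ← hvy j hj]
    exact Finset.sum_congr rfl fun i _ => by rw [hu]; ring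
  have hPx : ∀ j, k < j → P.eval (x j) = 0 := fun j hj => by rw [hP, hev]; exact hvx j hj
  obtain ⟨hG', -⟩ := favard_forms_rescaled hq0 hq1 hrec hq0' hq1' hrec' hb hb' hxr hyr hpair hpair' v u huv
  have hX := favard_forms_rescaled_abs_le hq0 hq1 hrec hq0' hq1' hrec' hb hb' hxr hyr hpair hpair' hα hδ0 hδ v u huv
  have hG : ∑ j, μ j * (P.eval (x j)) ^ 2 = ∑ i : Fin (t + 1), (∏ l ∈ Finset.Ico 1 ((i : ℕ) + 1), b l) * v i ^ 2 := by
    rw [hP]; exact favard_norm_sq_combination (h := fun n => ∏ l ∈ Finset.Ico 1 (n + 1), b l) hpair v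
  rw [← hP'] at hG' hX
  rw [← hP] at hX
  have hGpos : 0 < ∑ i : Fin (t + 1), (∏ l ∈ Finset.Ico 1 ((i : ℕ) + 1), b l) * v i ^ 2 := by
    obtain ⟨i₀, hi₀⟩ := Function.ne_iff.1 hv0
    exact Finset.sum_pos' (fun i _ => mul_nonneg (Finset.prod_nonneg fun l _ => (hb l).le) (sq_nonneg _))
      ⟨i₀, Finset.mem_univ _, mul_pos (Finset.prod_pos fun l _ => hb l) (sq_pos_iff.2 hi₀)⟩
  -- `y_k G ≤ Σ μ' y P'²`
  have h1 : y k * ∑ j, μ' j * (P'.eval (y j)) ^ 2 ≤ ∑ j, μ' j * (y j * (P'.eval (y j)) ^ 2) := by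
    rw [Finset.mul_sum, ← sub_nonneg, ← Finset.sum_sub_distrib]
    refine Finset.sum_nonneg fun j _ => ?_
    rw [show μ' j * (y j * (P'.eval (y j)) ^ 2) - y k * (μ' j * (P'.eval (y j)) ^ 2) = μ' j * ((y j - y k) * (P'.eval (y j)) ^ 2) by ring]
    rcases lt_or_ge j k with hjk | hjk
    · rw [hPy j hjk, sq, mul_zero, mul_zero, mul_zero]
    · exact mul_nonneg (hμ' j).le (mul_nonneg (sub_nonneg.2 (hy.monotone hjk)) (sq_nonneg _))
  -- `Σ μ x P² ≤ x_k G`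
  have h2 : ∑ j, μ j * (x j * (P.eval (x j)) ^ 2) ≤ x k * ∑ j, μ j * (P.eval (x j)) ^ 2 := by
    rw [Finset.mul_sum, ← sub_nonneg, ← Finset.sum_sub_distrib]
    refine Finset.sum_nonneg fun j _ => ?_
    rw [show x k * (μ j * (P.eval (x j)) ^ 2) - μ j * (x j * (P.eval (x j)) ^ 2) = μ j * ((x k - x j) * (P.eval (x j)) ^ 2) by ring]
    rcases lt_or_ge k j with hjk | hjk
    · rw [hPx j hjk, sq, mul_zero, mul_zero, mul_zero]
    · exact mul_nonneg (hμ j).le (mul_nonneg (sub_nonneg.2 (hx.monotone hjk)) (sq_nonneg _))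
  -- the Weyl difference
  have h3 : ∑ j, μ' j * (y j * (P'.eval (y j)) ^ 2) ≤ ∑ j, μ j * (x j * (P.eval (x j)) ^ 2) + (α + 2 * δ) * ∑ i : Fin (t + 1), (∏ l ∈ Finset.Ico 1 ((i : ℕ) + 1), b l) * v i ^ 2 := by
    have := (le_abs_self _).trans hX
    linarith
  rw [hG'] at h1
  rw [hG] at h2
  have h4 : y k * ∑ i : Fin (t + 1), (∏ l ∈ Finset.Ico 1 ((i : ℕ) + 1), b l) * v i ^ 2 ≤ (x k + (α + 2 * δ)) * ∑ i : Fin (t + 1), (∏ l ∈ Finset.Ico 1 ((i : ℕ) + 1), b l) * v i ^ 2 := by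
    rw [add_mul]; exact (h1.trans h3).trans (add_le_add h2 le_rfl)
  exact le_of_mul_le_mul_right h4 hGpos

/-- **WEYL'S PERTURBATION THEOREM FOR THE RECURRENCE: `|y_k − x_k| ≤ α + 2δ`** when `|a'_i − a_i| ≤ α` (`i ≤ t`) and `|√b'_j − √b_j| ≤ δ` (`1 ≤ j ≤ t`), both recurrences positive.
[Weyl 1912; Horn–Johnson Cor. 6.3.8; Parlett §10.1; Wilkinson Ch. 2 §44; this file, §1119] -/
theorem zeros_perturbation_full {q q' : ℕ → ℝ[X]} {a a' b b' : ℕ → ℝ} (hq0 : q 0 = 1) (hq1 : q 1 = Polynomial.X - C (a 0))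
    (hrec : ∀ n, q (n + 2) = (Polynomial.X - C (a (n + 1))) * q (n + 1) - C (b (n + 1)) * q n)
    (hq0' : q' 0 = 1) (hq1' : q' 1 = Polynomial.X - C (a' 0)) (hrec' : ∀ n, q' (n + 2) = (Polynomial.X - C (a' (n + 1))) * q' (n + 1) - C (b' (n + 1)) * q' n)
    (hb : ∀ j, 0 < b j) (hb' : ∀ j, 0 < b' j) {t : ℕ} {α δ : ℝ} (hα : ∀ i, i ≤ t → |a' i - a i| ≤ α) (hδ0 : 0 ≤ δ)
    (hδ : ∀ j, 1 ≤ j → j ≤ t → |Real.sqrt (b' j) - Real.sqrt (b j)| ≤ δ)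
    {x y : Fin (t + 1) → ℝ} (hx : StrictMono x) (hxq : q (t + 1) = ∏ j, (Polynomial.X - C (x j))) (hy : StrictMono y) (hyq : q' (t + 1) = ∏ j, (Polynomial.X - C (y j)))
    (k : Fin (t + 1)) : |y k - x k| ≤ α + 2 * δ := by
  have h1 := zeros_perturbation_full_upper hq0 hq1 hrec hq0' hq1' hrec' hb hb' hα hδ0 hδ hx hxq hy hyq k
  have h2 := zeros_perturbation_full_upper hq0' hq1' hrec' hq0 hq1 hrec hb' hb (fun i hi => by rw [abs_sub_comm]; exact hα i hi) hδ0
    (fun j hj hjt => by rw [abs_sub_comm]; exact hδ j hj hjt) hy hyq hx hxq k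
  rw [abs_le]
  constructor <;> linarith

end Summit.Ventures.HSemireg.Wedge.HankelOuter
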